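import Literature.Probability.Percolation.MarkedLoopSiteLawPattern
import HarnessLib

/-!
# Boundary mid-edges from flat boundary darts: the `ArcPoint` constructor («ARC-POINT-OF-DART»)

Topic `Literature/Probability/Percolation`; generic-`k` layer of the marked-loop (Khristoforov–Smirnov) lineage; a rider on `MarkedLoopBoundarySpan.lean` (the data of a boundary
mid-edge on an arc, `ArcPoint D a`: a face `v` with three `H_G`-sides, not a corner face, whose `i`-th side is the bond of a dart `(g, o)` of the stretch `A_a`, the face across it not
a corner face either) and on `MarkedLoopSiteLawPattern.lean` («LAW-SITE-LAW»).

`ArcPoint` was introduced abstractly (g22, #632); no member of it has yet been CONSTRUCTED in the tree. This file constructs them from the boundary geometry alone, which is what the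
sandpile-class programme of HOME `FINDING-BSPAN-SLIDE-INDUCTION.md` (G0) needs for every lawpoint:

* `allSides_leftFace_of_mem` — the face left of a dart `u → v` has all three sides in `H_G` as soon as `u` and the apex `triLeftApex u v` are sites of `G`;
* `not_mem_corners_of_allSides` — a face with three `H_G`-sides is not a corner face (a corner face has a side joining two outside sites, `exists_side_not_mem_hBonds_of_corner`);
* `oppFace_leftFace_eq` — across the bond `s(u, v)` from `leftFace u v` lies `leftFace v u`;
* ★★★ `ArcPoint.ofFlatDart` — **THE CONSTRUCTOR**: a dart `(g, o)` of the stretch `A_a` which is FLAT — both apices `triLeftApex g o` and `triLeftApex o g` of its bond are sites of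
  `G` (the bond is not at a convex vertex of the domain) — gives a boundary mid-edge `z : ArcPoint D a` read at `v = leftFace g o` across `s(g, o)`; `ofFlatDart_v`, `ofFlatDart_g`,
  `ofFlatDart_o`, `side_ofFlatDart`;
* ★ `lawLP_ofFlatDart_eq_of_tipFace` — (with «LAW-SITE-LAW») two flat darts of the home stretch forming a tip carry the same boundary law.

## References
* B. Bollobás, O. Riordan, *Percolation*, CUP (2006), Ch. 7 §7.2.2 (pp. 191–195): discrete domains, the boundary walk, the arcs `A_i`.
* M. Khristoforov, S. Smirnov, *Percolation and O(1) loop model*, arXiv:2111.15612 (2021), §1.2 (arXiv v1 p. 2), §2 eq. (4) and Remark 6 (p. 5: `z` on a boundary arc).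

## Mathlib / tree
Tree: `MarkedLoopBoundarySpan` (`ArcPoint`), `MarkedLoopBoundaryLawModule` (`lawLP`), `MarkedLoopSiteLawPattern` (`lawLP_eq_of_tipFace`), `MarkedLoopSpace` (`mem_hBonds`,
`exists_side_eq_of_inc`, `exists_side_not_mem_hBonds_of_corner`, `mem_corners`, `yc_spec`, `eq_or_eq_of_inc_three`, `mem_touching_of_side_mem`), `MarkedLoopBoundarySupport`
(`pos_facts_of_mem_stretch`), `TriDiscShelling` (`leftFace`, `hexFaceVertices_leftFace`, `triLeftApex_ne`, `adj_of_mem_hexFaceVertices`, `leftFace_ne_leftFace_symm`), `TriDiscreteDomain`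
(`triGraph_adj_triLeftApex_left`, `faceVertex_mem`, `faceVertex_injective`, `mem_triBdryDarts`), `FivePointNormalisation` (`side_oppFace_oppIdx`), `KhSThreeDisorderObservable` (`AllSides`).
-/

noncomputable section

open Finset

namespace Literature.Probability.Percolation.MarkedLoops

open Literature.Probability.Percolation Literature.Probability.LatticeModels
open Literature.Probability.Percolation.FivePoint (side side_injective Inc inc_side inc_mk_iff)
open Literature.Probability.Percolation.FivePoint.N5 (side_oppFace_oppIdx)
open TriMarkedDomain

variable {nm : ℕ} {D : TriMarkedDomain nm}

/-! ### Faces with three `H_G`-sides -/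

/-- Auxiliary: two 2-subsets of `Fin 3` meet. [cite: KhristoforovSmirnov2021, §1.2 (arXiv v1 p. 2)] -/
private theorem fin3_two_two (j a b : Fin 3) (hab : a ≠ b) : a = j + 1 ∨ a = j + 2 ∨ b = j + 1 ∨ b = j + 2 := by
  revert j a b; decide

/-- **a face two of whose vertices are sites of `G` has all three sides in `H_G`** (every side of the face contains one of the two). [cite: BollobasRiordan2006, Ch. 7 §7.2.2 pp. 191–195; KhristoforovSmirnov2021, §1.2 (arXiv v1 p. 2)] -/
theorem allSides_of_two_mem {F : HexVertex} {a b : Site 2} (ha : a ∈ hexFaceVertices F) (hb : b ∈ hexFaceVertices F) (hab : a ≠ b)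
    (haG : a ∈ D.verts) (hbG : b ∈ D.verts) : AllSides D F := by
  intro j
  obtain ⟨ia, rfl⟩ := mem_hexFaceVertices_iff_faceVertex.1 ha
  obtain ⟨ib, rfl⟩ := mem_hexFaceVertices_iff_faceVertex.1 hb
  have hiab : ia ≠ ib := fun e => hab (by rw [e])
  have h3 : (j + 1 : Fin 3) ≠ j + 2 := by revert j; decide
  have hne : faceVertex F (j + 1) ≠ faceVertex F (j + 2) := fun e => h3 (faceVertex_injective _ e)
  have hadj : triGraph.Adj (faceVertex F (j + 1)) (faceVertex F (j + 2)) :=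
    adj_of_mem_hexFaceVertices (faceVertex_mem _ _) (faceVertex_mem _ _) hne
  unfold side
  refine mem_hBonds D hadj ?_
  rcases fin3_two_two j ia ib hiab with h | h | h | h
  · exact Or.inl (h ▸ haG)
  · exact Or.inr (h ▸ haG)
  · exact Or.inl (h ▸ hbG)
  · exact Or.inr (h ▸ hbG)

/-- **the face left of a dart `u → v` with `u` and its apex in `G` has three `H_G`-sides.** [cite: BollobasRiordan2006, Ch. 7 §7.2.2 pp. 191–195] -/
theorem allSides_leftFace_of_mem {u v : Site 2} (hadj : triGraph.Adj u v) (hu : u ∈ D.verts) (hw : triLeftApex u v ∈ D.verts) : AllSides D (leftFace u v) :=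
  allSides_of_two_mem (F := leftFace u v) (by rw [hexFaceVertices_leftFace hadj]; simp) (by rw [hexFaceVertices_leftFace hadj]; simp)
    (triLeftApex_ne hadj).1.symm hu hw

/-- **the face left of a dart `u → v` with `v` and its apex in `G` has three `H_G`-sides.** [cite: BollobasRiordan2006, Ch. 7 §7.2.2 pp. 191–195] -/
theorem allSides_leftFace_of_mem' {u v : Site 2} (hadj : triGraph.Adj u v) (hv : v ∈ D.verts) (hw : triLeftApex u v ∈ D.verts) : AllSides D (leftFace u v) :=
  allSides_of_two_mem (F := leftFace u v) (by rw [hexFaceVertices_leftFace hadj]; simp) (by rw [hexFaceVertices_leftFace hadj]; simp)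
    (triLeftApex_ne hadj).2.symm hv hw

/-- **a face with three `H_G`-sides is not a corner face** (a corner face has a side joining two outside sites). [cite: KhristoforovSmirnov2021, §1.2 (arXiv v1 p. 2); BollobasRiordan2006, Ch. 7 §7.2.2 pp. 191–195] -/
theorem not_mem_corners_of_allSides {F : HexVertex} (hF : AllSides D F) : F ∉ corners D := by
  intro hc
  obtain ⟨i, rfl⟩ := (mem_corners D).1 hc
  obtain ⟨j, hj⟩ := exists_side_not_mem_hBonds_of_corner D (yc_spec D i)
  exact hj (hF j)

/-- **across the bond `s(u, v)` from `leftFace u v` lies `leftFace v u`.** [cite: KhristoforovSmirnov2021, §1.2 (arXiv v1 p. 2)] -/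
theorem oppFace_leftFace_eq {u v : Site 2} (hu : u ∈ D.verts) (hadj : triGraph.Adj u v) {j : Fin 3} (hj : side (leftFace u v) j = s(u, v)) :
    oppFace (leftFace u v) j = leftFace v u := by
  have hb : s(u, v) ∈ hBonds D := mem_hBonds D hadj (Or.inl hu)
  have hxt : leftFace u v ∈ triFacesTouching D.verts := mem_touching_of_side_mem D (j := j) (by rw [hj]; exact hb)
  have hot : oppFace (leftFace u v) j ∈ triFacesTouching D.verts :=
    mem_touching_of_side_mem D (j := oppIdx (leftFace u v) j) (by rw [side_oppFace_oppIdx, hj]; exact hb)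
  have hx't : leftFace v u ∈ triFacesTouching D.verts := by
    refine mem_triFacesTouching.2 ⟨u, hu, ?_⟩
    rw [hexFaceVertices_leftFace hadj.symm]; simp
  have ix : Inc (leftFace u v) s(u, v) := by rw [← hj]; exact inc_side _ _
  have io : Inc (oppFace (leftFace u v) j) s(u, v) := by rw [← hj, ← side_oppFace_oppIdx (leftFace u v) j]; exact inc_side _ _
  have ix' : Inc (leftFace v u) s(u, v) := by
    rw [inc_mk_iff, hexFaceVertices_leftFace hadj.symm]
    exact ⟨by simp, by simp⟩
  have hne : leftFace v u ≠ leftFace u v := (leftFace_ne_leftFace_symm hadj).symm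
  rcases eq_or_eq_of_inc_three D hb hxt hot hx't ix io ix' (hexGraph_adj_oppFace _ j).ne with e | e
  · exact absurd e hne
  · exact e.symm

/-! ### The constructor -/

/-- ★★★ **A BOUNDARY MID-EDGE FROM A FLAT DART OF AN ARC**: a dart `(g, o)` of the stretch `A_a` both of whose apices `triLeftApex g o`, `triLeftApex o g` are sites of `G` gives
an `ArcPoint D a` — read at the face `leftFace g o` across the bond `s(g, o)`; both faces of the bond have three `H_G`-sides, so neither is a corner face.
[cite: KhristoforovSmirnov2021, §2 eq. (4) and Remark 6 (arXiv v1 p. 5: `z` on the arc `u_{j−1}u_{j+1}`); BollobasRiordan2006, Ch. 7 §7.2.2 pp. 191–195] -/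
def ArcPoint.ofFlatDart {a : Fin nm} {g o : Site 2} (hd : (g, o) ∈ D.stretch a) (hw : triLeftApex g o ∈ D.verts) (hw' : triLeftApex o g ∈ D.verts) :
    ArcPoint D a :=
  have hbd : (g, o) ∈ triBdryDarts D.verts := (pos_facts_of_mem_stretch hd).2.2.2.2
  have hg : g ∈ D.verts := (mem_triBdryDarts.1 hbd).1
  have hadj : triGraph.Adj g o := (mem_triBdryDarts.1 hbd).2.2
  have hb : s(g, o) ∈ hBonds D := mem_hBonds D hadj (Or.inl hg)
  have hinc : Inc (leftFace g o) s(g, o) := by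
    rw [inc_mk_iff, hexFaceVertices_leftFace hadj]
    exact ⟨by simp, by simp⟩
  have hi := exists_side_eq_of_inc D hb hinc
  { v := leftFace g o
    i := hi.choose
    allSides := allSides_leftFace_of_mem hadj hg hw
    not_corner := not_mem_corners_of_allSides (allSides_leftFace_of_mem hadj hg hw)
    opp_not_corner := by
      rw [oppFace_leftFace_eq hg hadj hi.choose_spec.symm]
      exact not_mem_corners_of_allSides (allSides_leftFace_of_mem' hadj.symm hg hw')
    g := g
    o := o
    side_eq := hi.choose_spec.symm
    mem_stretch := hd }


/-- the face of `ofFlatDart`. [cite: KhristoforovSmirnov2021, §2 eq. (4) (arXiv v1 p. 5)] -/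
@[simp] theorem ArcPoint.ofFlatDart_v {a : Fin nm} {g o : Site 2} (hd : (g, o) ∈ D.stretch a) (hw : triLeftApex g o ∈ D.verts) (hw' : triLeftApex o g ∈ D.verts) :
    (ArcPoint.ofFlatDart hd hw hw').v = leftFace g o := rfl

/-- the inner site of `ofFlatDart`. [cite: KhristoforovSmirnov2021, §2 eq. (4) (arXiv v1 p. 5)] -/
@[simp] theorem ArcPoint.ofFlatDart_g {a : Fin nm} {g o : Site 2} (hd : (g, o) ∈ D.stretch a) (hw : triLeftApex g o ∈ D.verts) (hw' : triLeftApex o g ∈ D.verts) :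
    (ArcPoint.ofFlatDart hd hw hw').g = g := rfl

/-- the outer site of `ofFlatDart`. [cite: KhristoforovSmirnov2021, §2 eq. (4) (arXiv v1 p. 5)] -/
@[simp] theorem ArcPoint.ofFlatDart_o {a : Fin nm} {g o : Site 2} (hd : (g, o) ∈ D.stretch a) (hw : triLeftApex g o ∈ D.verts) (hw' : triLeftApex o g ∈ D.verts) :
    (ArcPoint.ofFlatDart hd hw hw').o = o := rfl

/-- the side read by `ofFlatDart` is the bond of the dart. [cite: KhristoforovSmirnov2021, §2 eq. (4) (arXiv v1 p. 5)] -/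
theorem ArcPoint.side_ofFlatDart {a : Fin nm} {g o : Site 2} (hd : (g, o) ∈ D.stretch a) (hw : triLeftApex g o ∈ D.verts) (hw' : triLeftApex o g ∈ D.verts) :
    side (ArcPoint.ofFlatDart hd hw hw').v (ArcPoint.ofFlatDart hd hw hw').i = s(g, o) :=
  (ArcPoint.ofFlatDart hd hw hw').side_eq

/-- ★ **two flat darts of the home stretch forming a tip carry the same boundary law** («LAW-SITE-LAW» for constructed mid-edges).
[cite: KhristoforovSmirnov2021, §1.2 (arXiv v1 p. 2: the law of the link pattern), §2 Remark 6 (p. 5)] -/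
theorem lawLP_ofFlatDart_eq_of_tipFace {n : ℕ} {D : TriMarkedDomain (n + 1)} {g o g' o' : Site 2}
    (hd : (g, o) ∈ D.stretch (Fin.last n)) (hw : triLeftApex g o ∈ D.verts) (hw' : triLeftApex o g ∈ D.verts)
    (hd' : (g', o') ∈ D.stretch (Fin.last n)) (hx : triLeftApex g' o' ∈ D.verts) (hx' : triLeftApex o' g' ∈ D.verts)
    (T : TipFace D (leftFace g o) (ArcPoint.ofFlatDart hd hw hw').i (leftFace g' o') (ArcPoint.ofFlatDart hd' hx hx').i) :
    lawLP (ArcPoint.ofFlatDart hd hw hw') = lawLP (ArcPoint.ofFlatDart hd' hx hx') :=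
  lawLP_eq_of_tipFace _ _ T

end Literature.Probability.Percolation.MarkedLoops
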